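import Summits.ABC.ABC.Theses.TwistAmplification
import Summits.ABC.ABC.Theorems.SomeWindowSaving.Negative.LowerLaw
import Summits.ABC.ABC.Theorems.SomeWindowSaving.Negative.LoadBearing
import Summits.ABC.ABC.Theorems.SomeWindowSaving.Negative.WindowSavingBelowThird
import Summits.ABC.ABC.Theorems.SomeWindowSaving.Negative.LowerLawSmallSigma

/-!
# Disproof of `SomeWindowSaving` (stmt-ABC-1976) — findings of the standing disprover (cdisprove gen 1–3)

Crux (route `TwistAmplification`, r3): `∃ κ σ δ C, 3 < κ < σ ∧ δ < (σ−κ)/(2σ−6) ∧ ∀ X ≥ 1,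
T⁺_[κ,σ](X) ≤ C X^δ`, `T⁺` = number of reduced global minimal models `W₀/ℤ` with `c₄ c₆ ≠ 0`,
conductor `N ≤ X`, `N^κ ≤ M⁺ := max(|Δ|,|c₄|³) ≤ N^σ` (`Negative.windowSet/windowCount`,
`someWindowSaving_iff : crux ↔ ∃ …, windowCount … ≤ C X^δ` is `Iff.rfl`).

**VERDICT (gen 1–3): RESISTS.**  The crux is EQUIVALENT to COFINITE WEAK GENERALIZED SZPIRO
(`CofiniteWeakGenSzpiro` below: `∃ K N₀, M⁺ ≤ N^K` for every minimal non-CM-j model of conductor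
`≥ N₀`) — the ⟹ direction modulo the route's own provable supports `QuadraticTwistInvariants`
(stmt-ABC-1977, Tate) and `TwistAmplificationLemma` (stmt-ABC-1978, elementary), the ⟸ direction
unconditionally (`someWindowSaving_iff_cofiniteWeakGenSzpiro`, §1).  Cofinite weak generalized
Szpiro is weak abc `c < rad(abc)^K` (open since Masser–Oesterlé 1985; B–G §12.5) up to Shafarevich
finiteness below `N₀`; no unconditional `¬` exists short of DISPROVING weak abc, and both lines on
file (`inert-box-collapse`: WeakSzpiro ∧ WeakHall; `polynomial-degree-suffices`: polynomial modular
degree) prove the crux only through (cofinite) weak generalized Szpiro, as the calibration forces.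

## Index (everything conclusive is LANDED under `Summits/ABC/ABC/Theorems/SomeWindowSaving/Negative/`)

* §1 CALIBRATION (this file, sorry-free): `CofiniteWeakGenSzpiro`,
  `cofiniteWeakGenSzpiro_of_someWindowSaving` (needs the two supports as hypotheses),
  `someWindowSaving_of_cofiniteWeakGenSzpiro` (unconditional), `someWindowSaving_iff_cofiniteWeakGenSzpiro`.
* §2 LOAD-BEARING (landed `Negative.LoadBearing`, p71767): each of `3 < κ`, `κ < σ`,
  `δ < (σ−κ)/(2σ−6)` is necessary for content — `someWindowSaving_trivial_without_lowerKappa /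
  upperSigma / threshold` (junk witnesses: empty windows `[−2,−1]`, `[5,4]`; junk exponent `2σ` from
  `windowCount_le_trivial : T ≤ 143742252 X^{2σ}`).  For an `∃`-crux these replace `_false_without_`.
* §3 REFUTED NATURAL STRENGTHENINGS = the unconditional LOWER LAW of the window count (landed):
  `not_windowSaving_below_third` (`0<κ<4, σ>12 ⇒ δ ≥ 1/3`, Frey curves of `1+(4p²−1)=4p²`,
  `Negative.WindowSavingBelowThird` p70816); `not_windowSaving_below_law` (`3<κ<4, σ>12 ⇒ δ ≥ 1−κ/6`,
  prime twists of that family, `Negative.LowerLaw` p71460) — the conjectural law `X^{1−κ/6}` of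
  `SharpModerateLaw` realised from below; the crux survives by exactly the margin
  `(σ−κ)/(2σ−6) − (1−κ/6) = (κ−3)(σ−6)/(3(2σ−6))`, positive iff `σ > 6`.
* §3' NEW (gen 3, 2026-08-16; LANDED `Negative/TwistEdges.lean` p73335, `Negative/LowerLawSmallSigma.lean`
  p74485): the lower law for EVERY `σ > 3` under `κ(2σ+3) < 9σ` (`not_windowSaving_below_law'`), whence
  `no_witness_of_sigma_le_six`: **a crux witness with `σ ≤ 6` needs `κ ≥ 9σ/(2σ+3)`** (there the
  threshold is `≤` the law, `threshold_le_law_of_sigma_le_six`).  Re-exported below.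
* REMARKS (no theorem needed). (i) The calibration's exponent is forced ABOVE SZPIRO'S 6: the tree PROVES
  Masser's theorem (`Literature.Barriers.ABC.masser_theorem`, `SzpiroEpsilonCannotBeDropped_holds`:
  semistable curves of arbitrarily large conductor with `|Δ_min| > N⁶`), so `CofiniteWeakGenSzpiro` can
  only hold with `K > 6` and every inert-box witness has `κ > 7` in effect (modulo packaging a semistable
  `W/ℚ` as a reduced minimal `W₀/ℤ` with `c₄c₆ ≠ 0`, which multiplicative reduction gives).
  (ii) HYPOTHESIS MUTATION: the CM-j exclusion `c₄ ≠ 0 ∧ c₆ ≠ 0` is NOT load-bearing for THIS `∃`-crux —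
  without it the sextic/quartic twist families `y² = x³ + ℓ⁵m`, `y² = x³ + ℓ³x` (ratios `→ 5`, `9/2`,
  `≫ X^{1/2−o(1)}` members) kill every witness with `κ < 5`, but high windows stay finite under WGS
  (CM-j curves satisfy `M⁺ ≪ N^{5+o(1)}` trivially), so the mutated statement is still `↔` cofinite WGS;
  the exclusion is load-bearing only for the `∀σ` target `ModerateWindowCount` and for `SharpModerateLaw`.
* §4 TIGHTNESS of the amplification bookkeeping (this file): `margin_identity`,
  `threshold_lt_half`, `threshold_strictMono` (the exponent `(s−κ)/(2s−6)` is increasing in `s`).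
* §5 NEAR-MISSES (this file, the ONLY `sorry`s): the slack-free lower law (`3<κ<4`, any `σ>κ`),
  the full `σ ≤ 6` exclusion, the law on `4 ≤ κ < 6` — each with its obstruction.
* §6 TARGETS: the lead's stub lists (lines `polynomial-degree-suffices`, `inert-box-collapse`) —
  triaged, none refutable: see the comment block at the end.

Attacks tried (gen 1–3) and why the crux resists — one line each:
* junk/degenerate parameters (`δ ≤ 0`, `σ ≤ 6`, `κ → 3⁺`, empty windows): all absorbed — `δ = 0` with a
  FINITE window is exactly how WGS proves the crux; `σ ≤ 6 ∧ κ < 9σ/(2σ+3)` is refuted (§3'), not the crux.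
* small models: every window slice is finite (`windowSet_finite`), no `ncard` junk; `N ≥ 1`
  (`conductorNorm_pos_holds`), `|Δ| ≥ 1`, no model with `|Δ| = |c₄| = 1` (`no_model_with_unit_invariants`).
* abundant families (Frey, twisted Frey): give the law `X^{1−κ/6}` for `κ < 4`, strictly below the
  threshold when `σ > 6` — the crux was designed around this margin.
* literature negatives (`ledger negatives --problem ABC`; barrier catalogue `SzpiroEpsilonCannotBeDropped`,
  `HallExponentSharp`, `BakerMethodBounds`): none bites an `∃`-exponent statement.
-/

noncomputable section

set_option linter.dupNamespace false

open IsDedekindDomain WeierstrassCurve Real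
open Summit.ABC.ABC.Theses.TwistAmplification
open Summit.ABC.ABC.Theorems.SomeWindowSaving.Negative

namespace Summit.ABC.ABC.Cruxes.SomeWindowSaving.Disproof

/-! ## §1 Calibration: the crux is cofinite weak generalized Szpiro -/

/-- **Cofinite weak generalized Szpiro** (B–G Conj. 12.5.11 with `6 + ε ↦` SOME `K`, for minimal
integral models with `c₄ c₆ ≠ 0` and conductor `≥ N₀`): the pointwise content of the crux. -/
def CofiniteWeakGenSzpiro : Prop :=
  ∃ K N₀ : ℝ, ∀ W₀ : WeierstrassCurve ℤ, (W₀.baseChange ℚ).IsElliptic →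
    (∀ v : HeightOneSpectrum ℤ, (W₀.baseChange ℚ).IsMinimalAt v) → W₀.c₄ ≠ 0 → W₀.c₆ ≠ 0 →
      N₀ ≤ (((W₀.baseChange ℚ).conductorNorm ℤ : ℕ) : ℝ) →
        ((max |W₀.Δ| (|W₀.c₄| ^ 3) : ℤ) : ℝ) ≤ (((W₀.baseChange ℚ).conductorNorm ℤ : ℕ) : ℝ) ^ K

/-- (⟹) The crux gives cofinite weak generalized Szpiro, through the route's supports
`QuadraticTwistInvariants` (stmt-ABC-1977) and `TwistAmplificationLemma` (stmt-ABC-1978): one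
application of the amplification lemma at `σ' := σ + 1`. -/
theorem cofiniteWeakGenSzpiro_of_someWindowSaving (hT : QuadraticTwistInvariants)
    (hA : TwistAmplificationLemma) (h : SomeWindowSaving) : CofiniteWeakGenSzpiro := by
  obtain ⟨κ, σ, δ, C, hκ, hκσ, hδ, hcount⟩ := h
  obtain ⟨N₀, hN₀⟩ := hA hT κ σ δ C hκ hκσ hδ hcount (σ + 1) (by linarith)
  exact ⟨σ + 1, N₀, fun W₀ hE hmin hc₄ hc₆ hN ↦ hN₀ W₀ hE hmin hc₄ hc₆ hN⟩

/-- (⟸, unconditional; no Shafarevich finiteness, no counting) cofinite weak generalized Szpiro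
gives the crux with the witness `κ := K'+1`, `σ := K'+2`, `δ := 0`, `K' := max K 3`: a window member
of conductor `N ≥ max N₀ 2` would have `N^{K'+1} ≤ M⁺ ≤ N^K ≤ N^{K'}`, impossible for `N ≥ 2`; so
every slice sits inside the fixed finite slice at scale `max N₀ 2` (`windowSet_finite`). -/
theorem someWindowSaving_of_cofiniteWeakGenSzpiro (h : CofiniteWeakGenSzpiro) : SomeWindowSaving := by
  obtain ⟨K, N₀, h⟩ := h
  set K' : ℝ := max K 3 with hK'
  have hK'3 : (3 : ℝ) ≤ K' := le_max_right _ _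
  have hKK' : K ≤ K' := le_max_left _ _
  set X₀ : ℝ := max N₀ 2 with hX₀
  have hsub : ∀ X : ℝ, windowSet (K' + 1) (K' + 2) X ⊆ windowSet (K' + 1) (K' + 2) X₀ := by
    intro X W hW
    have hW' := hW
    obtain ⟨hE, hmin, ha₁, ha₃, ha₂, hc₄, hc₆, -, hlo, -⟩ := hW'
    obtain ⟨hE', hmin', ha₁', ha₃', ha₂', hc₄', hc₆', -, hlo', hhi'⟩ := hW
    refine ⟨hE', hmin', ha₁', ha₃', ha₂', hc₄', hc₆', ?_, hlo', hhi'⟩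
    set n : ℝ := (((W.baseChange ℚ).conductorNorm ℤ : ℕ) : ℝ) with hn
    by_contra hlt
    rw [not_le] at hlt
    have hN₀ : N₀ ≤ n := le_trans (le_max_left _ _) hlt.le
    have hn2 : (2 : ℝ) ≤ n := le_trans (le_max_right _ _) hlt.le
    have hn1 : (1 : ℝ) < n := by linarith
    have hM := h W hE hmin hc₄ hc₆ hN₀
    have h1 : n ^ (K' + 1) ≤ n ^ K' :=
      calc n ^ (K' + 1) ≤ ((max |W.Δ| (|W.c₄| ^ 3) : ℤ) : ℝ) := hlo
        _ ≤ n ^ K := hM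
        _ ≤ n ^ K' := Real.rpow_le_rpow_of_exponent_le hn1.le hKK'
    have h2 : n ^ K' < n ^ (K' + 1) := Real.rpow_lt_rpow_of_exponent_lt hn1 (by linarith)
    linarith
  refine ⟨K' + 1, K' + 2, 0, ((windowSet (K' + 1) (K' + 2) X₀).ncard : ℝ), by linarith, by linarith,
    ?_, fun X _ ↦ ?_⟩
  · rw [show (K' + 2 - (K' + 1)) / (2 * (K' + 2) - 6) = 1 / (2 * K' - 2) by ring]
    exact div_pos one_pos (by linarith)
  · rw [Real.rpow_zero, mul_one]
    exact_mod_cast Set.ncard_le_ncard (hsub X) (windowSet_finite _ _ _)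

/-- **Calibration.**  Modulo the route's two provable supports, the crux IS cofinite weak
generalized Szpiro = weak abc `c < rad^K` (open since 1985): `SomeWindowSaving ↔ CofiniteWeakGenSzpiro`.
So the counting dress of the crux carries no statistical content — every proof is a pointwise
bound for ALL non-CM-j curves of large conductor, and no disproof exists short of `¬` weak abc. -/
theorem someWindowSaving_iff_cofiniteWeakGenSzpiro (hT : QuadraticTwistInvariants)
    (hA : TwistAmplificationLemma) : SomeWindowSaving ↔ CofiniteWeakGenSzpiro :=
  ⟨cofiniteWeakGenSzpiro_of_someWindowSaving hT hA, someWindowSaving_of_cofiniteWeakGenSzpiro⟩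

/-! ## §2–§3 Landed negative theorems, re-exported (kernel-checked pointers) -/

/-- §2 Load-bearing: without `3 < κ` a junk witness exists (`Negative.LoadBearing`). -/
example : ∃ κ σ δ C : ℝ, κ < σ ∧ δ < (σ - κ) / (2 * σ - 6) ∧
    ∀ X : ℝ, 1 ≤ X → (windowCount κ σ X : ℝ) ≤ C * X ^ δ :=
  someWindowSaving_trivial_without_lowerKappa

/-- §2 Load-bearing: without `κ < σ` a junk witness exists. -/
example : ∃ κ σ δ C : ℝ, 3 < κ ∧ δ < (σ - κ) / (2 * σ - 6) ∧
    ∀ X : ℝ, 1 ≤ X → (windowCount κ σ X : ℝ) ≤ C * X ^ δ :=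
  someWindowSaving_trivial_without_upperSigma

/-- §2 Load-bearing: without `δ < (σ−κ)/(2σ−6)` the junk exponent `2σ` is a witness. -/
example : ∃ κ σ δ C : ℝ, 3 < κ ∧ κ < σ ∧
    ∀ X : ℝ, 1 ≤ X → (windowCount κ σ X : ℝ) ≤ C * X ^ δ :=
  someWindowSaving_trivial_without_threshold

/-- §3 Refuted strengthening: `κ < 4`, `σ > 12` ⇒ no saving `δ < 1/3` (`Negative.WindowSavingBelowThird`). -/
example : ¬ ∃ κ σ δ C : ℝ, 0 < κ ∧ κ < 4 ∧ 12 < σ ∧ δ < 1 / 3 ∧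
    ∀ X : ℝ, 1 ≤ X → (windowCount κ σ X : ℝ) ≤ C * X ^ δ :=
  not_windowSaving_below_third

/-- §3 Refuted strengthening = SHARP LOWER LAW: `3 < κ < 4`, `σ > 12` ⇒ no saving `δ < 1 − κ/6`
(`Negative.LowerLaw`). -/
example : ¬ ∃ κ σ δ C : ℝ, 3 < κ ∧ κ < 4 ∧ 12 < σ ∧ δ < 1 - κ / 6 ∧
    ∀ X : ℝ, 1 ≤ X → (windowCount κ σ X : ℝ) ≤ C * X ^ δ :=
  not_windowSaving_below_law

/-- §3' NEW (gen 3, landed `Negative.LowerLawSmallSigma`): the lower law for every `σ > 3` under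
`κ(2σ+3) < 9σ`. -/
example : ¬ ∃ κ σ δ C : ℝ, 3 < κ ∧ κ < 4 ∧ 3 < σ ∧ κ * (2 * σ + 3) < 9 * σ ∧ δ < 1 - κ / 6 ∧
    ∀ X : ℝ, 1 ≤ X → (windowCount κ σ X : ℝ) ≤ C * X ^ δ :=
  not_windowSaving_below_law'

/-- §3' NEW (gen 3): **no witness of the crux with `σ ≤ 6` and `κ < 9σ/(2σ+3)`.** -/
example : ¬ ∃ κ σ δ C : ℝ, 3 < κ ∧ κ < σ ∧ σ ≤ 6 ∧ κ * (2 * σ + 3) < 9 * σ ∧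
    δ < (σ - κ) / (2 * σ - 6) ∧
    ∀ X : ℝ, 1 ≤ X → (windowCount κ σ X : ℝ) ≤ C * X ^ δ :=
  no_witness_of_sigma_le_six

/-- §3' in `_false_with_` form: the crux's matrix conjoined with `σ ≤ 6 ∧ κ(2σ+3) < 9σ` is
unsatisfiable — any proof of `SomeWindowSaving` must produce `σ > 6` or `κ ≥ 9σ/(2σ+3)`. -/
theorem someWindowSaving_matrix_false_with_small_sigma :
    ¬ ∃ κ σ δ C : ℝ, (σ ≤ 6 ∧ κ * (2 * σ + 3) < 9 * σ) ∧ 3 < κ ∧ κ < σ ∧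
        δ < (σ - κ) / (2 * σ - 6) ∧
        ∀ X : ℝ, 1 ≤ X → (windowCount κ σ X : ℝ) ≤ C * X ^ δ :=
  someWindowSaving_false_with_sigma_le_six

/-! ## §4 Tightness of the amplification bookkeeping (elementary identities the provers rely on) -/

/-- The margin identity: threshold minus law `= (κ−3)(σ−6)/(3(2σ−6))` (`σ ≠ 3`). -/
theorem margin_identity {κ σ : ℝ} (hσ : σ ≠ 3) :
    (σ - κ) / (2 * σ - 6) - (1 - κ / 6) = (κ - 3) * (σ - 6) / (3 * (2 * σ - 6)) := by
  have h : 2 * σ - 6 ≠ 0 := by intro h; apply hσ; linarith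
  have h3 : 3 * (2 * σ - 6) ≠ 0 := mul_ne_zero three_ne_zero h
  have e : (2 * σ - 6)⁻¹ * (2 * σ - 6) = 1 := inv_mul_cancel₀ h
  rw [eq_div_iff h3]
  linear_combination (3 * (σ - κ)) * e

/-- The margin is positive exactly in the crux's intended regime `κ > 3`, `σ > 6` … -/
theorem margin_pos {κ σ : ℝ} (hκ : 3 < κ) (hσ : 6 < σ) :
    1 - κ / 6 < (σ - κ) / (2 * σ - 6) := by
  have hden : 0 < 2 * σ - 6 := by linarith
  rw [lt_div_iff₀ hden]; nlinarith

/-- … and non-positive for `σ ≤ 6` (`κ > 3`, `σ > 3`): there the law beats every admissible saving. -/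
theorem margin_nonpos {κ σ : ℝ} (hκ : 3 < κ) (hσ3 : 3 < σ) (hσ : σ ≤ 6) :
    (σ - κ) / (2 * σ - 6) ≤ 1 - κ / 6 := by
  have hden : 0 < 2 * σ - 6 := by linarith
  rw [div_le_iff₀ hden]; nlinarith

/-- The threshold is always `< 1/2` (`3 < κ < σ`): any witness is a count with power saving
past `1/2` in a window reaching below ratio `σ`, past every uniform count in print
(SSW 2021: ratio `< 7/4`; Xiao 2024: `155/68`). -/
theorem threshold_lt_half {κ σ : ℝ} (hκ : 3 < κ) (hκσ : κ < σ) :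
    (σ - κ) / (2 * σ - 6) < 1 / 2 := by
  have hden : 0 < 2 * σ - 6 := by linarith
  rw [div_lt_iff₀ hden]; nlinarith

/-- `s ↦ (s − κ)/(2s − 6)` is strictly increasing on `s > 3` for `κ > 3` (the amplification step:
a violator of ratio `β₀ > σ` produces `X^{(β₀−κ)/(2β₀−6) − o(1)} > X^{(σ−κ)/(2σ−6)}` window curves). -/
theorem threshold_strictMono {κ s₁ s₂ : ℝ} (hκ : 3 < κ) (h₁ : 3 < s₁) (h₁₂ : s₁ < s₂) :
    (s₁ - κ) / (2 * s₁ - 6) < (s₂ - κ) / (2 * s₂ - 6) := by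
  have hd₁ : 0 < 2 * s₁ - 6 := by linarith
  have hd₂ : 0 < 2 * s₂ - 6 := by linarith
  rw [div_lt_div_iff₀ hd₁ hd₂]; nlinarith

/-- The twist-orbit exponent identity behind the law: a one-parameter Mason–Stothers-extremal
family of degree `n` (conductor `≍ T^{n+1}`, `M⁺ ≍ T^{6n}`, ratio `6n/(n+1)`) twisted to ratio `κ`
contributes `X^{(1+θ)/(n+1+2θ)}` with `θ = (6n − κ(n+1))/(2κ−6)`, and this exponent is `1 − κ/6`
INDEPENDENTLY of `n` — which is why every extremal family lands exactly ON the law. -/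
theorem orbit_exponent_identity {κ n : ℝ} (hκ : 3 < κ) (hn : 1 < n) :
    (1 + (6 * n - κ * (n + 1)) / (2 * κ - 6)) / (n + 1 + 2 * ((6 * n - κ * (n + 1)) / (2 * κ - 6)))
      = 1 - κ / 6 := by
  have h1 : 2 * κ - 6 ≠ 0 := by intro h; linarith
  set θ : ℝ := (6 * n - κ * (n + 1)) / (2 * κ - 6) with hθdef
  have hθ : θ * (2 * κ - 6) = 6 * n - κ * (n + 1) := div_mul_cancel₀ _ h1
  have hD : n + 1 + 2 * θ ≠ 0 := by
    intro hD0
    have : (n + 1 + 2 * θ) * (2 * κ - 6) = 6 * (n - 1) := by linear_combination 2 * hθ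
    rw [hD0, zero_mul] at this
    have : n - 1 = 0 := by linarith
    linarith
  rw [div_eq_iff hD]
  linear_combination (1 / 6) * hθ

/-! ## §5 Near-misses (the ONLY `sorry`s of this file): true-looking negative targets not closed -/

/-- NEAR-MISS 1 (slack-free lower law).  For `3 < κ < 4` and ANY `σ > κ` the twisted Frey family
should still realise the law inside `[κ, σ]`: members with `4p² − 1` squarefree have conductor
`N = 2^{f₂}·p(4p²−1)d²` EXACTLY, ratio `(12+6θ)/(3+2θ) ∈ (3,4)` sliding through the window.
OBSTRUCTION: the landed membership lemmas only know `p d² ∣ N ≤ 2¹³p³d²` (radical of `4p²−1`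
uncontrolled pointwise), costing the constraint `κ(2σ+3) < 9σ` of §3'.  FIX (not done, ~600 lines):
sieve the `p`-range to squarefree `p(2p−1)(2p+1)` (density `≥ 1 − 1/4 − 1/3 − 3·Σ_{q≥5,(q,6)=1} q⁻²
≥ 0.12`, explicit `π²/6` bounds) and use `dvd_conductorNorm_of_twistCovariants` at every odd prime of
`4p²−1`.  Tried: nothing beyond the density computation. -/
theorem nearMiss_slackFree_lowerLaw :
    ¬ ∃ κ σ δ C : ℝ, 3 < κ ∧ κ < 4 ∧ κ < σ ∧ δ < 1 - κ / 6 ∧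
        ∀ X : ℝ, 1 ≤ X → (windowCount κ σ X : ℝ) ≤ C * X ^ δ := by
  sorry

/-- NEAR-MISS 2 (the law on `4 ≤ κ < 6`).  Mason–Stothers-extremal one-parameter abc families of
degree `n` have generalized-Szpiro ratio `6n/(n+1)` (`n = 2`: `1 + (4p²−1) = 4p²`, ratio 4, USED;
`n = 3`: `(t−1)³ + 2(3t²+1) = (t+1)³`, ratio `9/2`; `n = 2m`: Chebyshev
`T_m(x)² − (x²−1)U_{m−1}(x)² = 1`, ratio `12m/(2m+1) → 6`), and by `orbit_exponent_identity` their
prime twists realise `X^{1−κ/6}` for every `κ < 6n/(n+1)`.  Expected theorem: for `3 < κ < 6 < σ`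
(`σ` large) no saving `δ < 1 − κ/6`.  OBSTRUCTION: each new family needs its reduced minimal model,
`c₄, c₆, Δ` identities, minimality and conductor divisibilities (≈ the 1500 lines gen 2 spent on
`n = 2`), plus the same radical slack.  Not attempted in Lean. -/
theorem nearMiss_lowerLaw_upTo_six :
    ¬ ∃ κ σ δ C : ℝ, 3 < κ ∧ κ < 6 ∧ 36 < σ ∧ δ < 1 - κ / 6 ∧
        ∀ X : ℝ, 1 ≤ X → (windowCount κ σ X : ℝ) ≤ C * X ^ δ := by
  sorry

/-- NEAR-MISS 3 (full small-`σ` exclusion).  Conjecturally NO witness of the crux has `σ ≤ 6`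
(for `σ ≤ 6` the threshold is `≤` the law, `margin_nonpos`, and the law should hold in every window
`[κ, σ] ⊂ (3, 6]` containing an extremal ratio).  PROVED part (§3', `no_witness_of_sigma_le_six`):
`κ < 9σ/(2σ+3)`.  Missing: `9σ/(2σ+3) ≤ κ < σ ≤ 6` — needs NEAR-MISS 1 (for `κ < 4`) and NEAR-MISS 2
(for `κ ≥ 4`, with base ratio `≤ σ`, i.e. extremal families of ratio in `(κ, σ]`, which exist only
for the discrete ratios `6n/(n+1)`, `12m/(2m+1)`: windows avoiding all of them stay open even
conjecturally-by-construction). -/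
theorem nearMiss_no_witness_sigma_le_six :
    ¬ ∃ κ σ δ C : ℝ, 3 < κ ∧ κ < σ ∧ σ ≤ 6 ∧ δ < (σ - κ) / (2 * σ - 6) ∧
        ∀ X : ℝ, 1 ≤ X → (windowCount κ σ X : ℝ) ≤ C * X ^ δ := by
  sorry

/-! ## §6 Targets: the lead's stubs (2026-08-16) — triage, no kill

Line `polynomial-degree-suffices` (`Lines/polynomial-degree-suffices.lean`):
* `stub_polyDegreeSemistable` (∃ κ C, semistable `W` ⇒ ∃ D : ModularParametrizationData W N_W,
  deg ≤ C N^κ): OPEN (Frey's degree conjecture with an inert exponent; contains weak abc for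
  `16 ∣ abc` triples).  Interface check: `ModularParametrizationData` (Literature `ModularCurve.lean`)
  is an HONEST hypothesis structure — `f : CuspForm (Γ₀ N) 2` with `IsNewformOf W f :=
  IsNewform0 f ∧ ∀ n, aₙ(f) = aₙ(W)`, a Néron `PeriodPair`, a surjective uniformisation with kernel
  the lattice, Manin `c : ℤ` with `c Λ_f ⊆ Λ_E`, `deg` pinned by `deg_spec` (generic fibre orbit
  count of `τ ↦ uniformize (c ∫ f)`); `c = 0` is excluded by `deg_spec ∧ 0 < deg`, junk data can only
  ENLARGE `deg` (by `[Λ_E : cΛ_f]`), and the `c²`-normalised `PolyDegreeAll` is datum-independent.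
  Inhabitation is the named modularity fact (`Nonempty (ModularParametrizationData W N_W)`,
  `ModularCurve.lean` l.487) — so the `∃ D` conclusions are provable only THROUGH that fact, never
  refutable by junk.  No kill.
* `stub_semistableToAll` (PolyDegreeSemistable → PolyDegreeAll): an implication between two open
  statements; false only if `PolyDegreeAll` fails, i.e. only if weak Szpiro fails for an additive
  family — none known.  No kill; it is the honest hard core (contains weak Hall on the Mordell–Hall
  curves `Y² = X³ − 3xX − 2y`).
* `stub_zagierSilvermanBridge` (PolyDegreeAll → WeakGeneralizedSzpiro): provable now from proved tree
  facts (Zagier identity, Petersson lower bound at `ε = 1`, Silverman covolume inequality) — positive,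
  not the disprover's to land.

Line `inert-box-collapse` (`Lines/inert-box-collapse.lean`): `stub_weakSzpiro` (Oesterlé's weak
Szpiro, all `E/ℚ`) and `stub_weakHall` (`∃ θ > 0`, Hall's bound) — famous open problems, both implied
by `ABC` through proved tree theorems (`stubs_of_abc` in that file), hence irrefutable short of `¬ABC`;
`HallBound θ C` quantifies over positive naturals with `x³ ≠ y²` (no junk: `|x³ − y²| ≥ 1` but
`C x^θ → ∞`).  No kill.
-/

end Summit.ABC.ABC.Cruxes.SomeWindowSaving.Disproof

end
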